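import Summits.Ventures.PercRepro.C025ProfileGenRule
import Summits.Ventures.PercRepro.C025ProfileRankFourCapA

/-!
# The general certificate: (Cap)(a) and (b) in every rank (night-3 g8)

NIGHT3-G8-GENERAL-CERTIFICATE.md §3(a)(b) for the rule `wgn`:
* (Cap)(a) `cap_wgn_of_card_three`: a triangle pays at most `3` — a pair pays `≤ 1` unless BAD (`j = 2`, `r + 1 = p`),
  when it pays `(p+2)/p` and (the tree's `crk_eq_and_jB_eq_zero_of_bad_pair`) its two neighbours pay `r/(r+1)` each:
  `(p+2)/p + 2(p−1)/p = 3`. No rank hypothesis is needed;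
* (Cap)(b) `cap_wgn_card_four_of_no_triple`: six pairs at `≤ 1/2`.
-/

open scoped Matroid

namespace PercRepro

open Set Finset ThmH

section GenCapAB

variable {α : Type} [DecidableEq α] {M : Matroid α} [M.Finite]

/-- **(Cap)(b) in every rank**: a four-point rank-`3` set without a collinear triple pays at most `3`. -/
theorem cap_wgn_card_four_of_no_triple {S : Finset α} (hS4 : S.card = 4)
    (htri : ∀ T ⊆ S, T.card = 3 → M.eRk (T : Set α) = 3) :
    ∑ B ∈ (Profile.Rq M 2).filter (fun B => B ⊆ S), wgn M B S ≤ 3 := by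
  have hle : ∀ B ∈ (Profile.Rq M 2).filter (fun B => B ⊆ S), wgn M B S ≤ 1 / 2 := by
    intro B hB
    have hBc := card_eq_two_of_mem_filter_no_triple htri hB
    have hBS : B ⊆ S := (Finset.mem_filter.1 hB).2
    apply wgn_le_half_of_sdiff_card_two _ hBc
    rw [Finset.card_sdiff_of_subset hBS, hS4, hBc]
  calc ∑ B ∈ (Profile.Rq M 2).filter (fun B => B ⊆ S), wgn M B S
      ≤ ∑ _B ∈ (Profile.Rq M 2).filter (fun B => B ⊆ S), (1 / 2 : ℚ) := Finset.sum_le_sum hle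
    _ = (((Profile.Rq M 2).filter (fun B => B ⊆ S)).card : ℚ) * (1 / 2) := by
        rw [Finset.sum_const, nsmul_eq_mul]
    _ ≤ 6 * (1 / 2) := by
        have := card_filter_Rq_two_le_six_of_no_triple hS4 htri
        have h' : (((Profile.Rq M 2).filter (fun B => B ⊆ S)).card : ℚ) ≤ 6 := by exact_mod_cast this
        linarith
    _ = 3 := by norm_num

/-- A pair of a rank-`3` set with one extra point pays at most `1` unless it is bad, when it pays `(p+2)/p`. -/
theorem wgn_le_of_pair_sdiff_one {B S : Finset α} (he : (S \ B).card = 1) (hB2 : B.card = 2) :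
    (¬ (jB M B = 2 ∧ crk M S + 1 = crk M B) → wgn M B S ≤ 1) ∧
    (jB M B = 2 → crk M S + 1 = crk M B → wgn M B S ≤ ((crk M B : ℚ) + 2) / (crk M B : ℚ)) := by
  by_cases hp3 : crk M B < 3
  · rw [wgn_eq_zero_of_crk_lt_three hp3]
    constructor
    · intros; norm_num
    · intros; positivity
  push Not at hp3
  have hpr : crk M B ≤ crk M S + 1 := by
    obtain ⟨y, hy⟩ := Finset.card_eq_one.1 he
    exact crk_le_crk_add_one_of_sdiff_singleton hy
  have hprq : (crk M B : ℚ) ≤ (crk M S : ℚ) + 1 := by exact_mod_cast hpr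
  have hrpos : (0 : ℚ) < (crk M S : ℚ) + 1 := by positivity
  have hj2 : jB M B ≤ 2 := by unfold jB; exact min_le_left _ _
  unfold wgn
  rw [wg_of_sdiff_card_one_of_card_two he hB2 hp3]
  constructor
  · intro hnot
    apply max_le (by norm_num)
    split_ifs with h0 h1 h2
    · rw [div_le_iff₀ hrpos]; linarith
    · norm_num
    · exfalso
      exact hnot ⟨by omega, h2⟩
    · norm_num
  · intro hj hc
    have h0 : jB M B ≠ 0 := by omega
    have h1 : jB M B ≠ 1 := by omega
    rw [if_neg h0, if_neg h1, if_pos hc]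
    exact max_le (by positivity) le_rfl

/-- **The bad-pair bound in every rank**: if `{x, y}` is a bad pair of the triangle `S = {x, y, z}` (`j = 2`,
`r + 1 = p`), the pair `{x, z}` pays at most `r/(r + 1)`. -/
theorem wgn_le_of_bad_pair (hsimple : ∀ T ⊆ M.E, T.encard ≤ 2 → M.Indep T) {x y z : α} (hxy : x ≠ y) (hxz : x ≠ z)
    (hyz : y ≠ z) (hxg : x ∈ gr M) (hyg : y ∈ gr M) (hzg : z ∈ gr M)
    (hS : insert z ({x, y} : Finset α) ∈ Shadow.levelSet M 3) (hj : jB M {x, y} = 2)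
    (hbad : crk M (insert z ({x, y} : Finset α)) + 1 = crk M {x, y}) :
    wgn M {x, z} (insert z ({x, y} : Finset α)) ≤
      (crk M (insert z ({x, y} : Finset α)) : ℚ) / ((crk M (insert z ({x, y} : Finset α)) : ℚ) + 1) := by
  obtain ⟨hcrk, hj0⟩ := crk_eq_and_jB_eq_zero_of_bad_pair hsimple hxy hxz hyz hxg hyg hzg hS hj hbad
  have hrnn : (0 : ℚ) ≤ (crk M (insert z ({x, y} : Finset α)) : ℚ) := Nat.cast_nonneg _
  by_cases hlt : crk M {x, z} < 3
  · rw [wgn_eq_zero_of_crk_lt_three hlt]; positivity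
  push Not at hlt
  have hsd : (insert z ({x, y} : Finset α) \ {x, z}).card = 1 := by
    have : insert z ({x, y} : Finset α) \ {x, z} = {y} := by
      ext w
      simp only [Finset.mem_sdiff, Finset.mem_insert, Finset.mem_singleton, not_or]
      constructor
      · rintro ⟨hw, hwx, hwz⟩
        rcases hw with rfl | rfl | rfl
        · exact absurd rfl hwz
        · exact absurd rfl hwx
        · rfl
      · rintro rfl
        exact ⟨Or.inr (Or.inr rfl), hxy.symm, hyz⟩
    rw [this, Finset.card_singleton]
  unfold wgn
  rw [wg_of_sdiff_card_one_of_card_two hsd (Finset.card_pair hxz) hlt, if_pos hj0, hcrk]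
  apply max_le
  · exact div_nonneg hrnn (by linarith)
  · exact le_rfl

/-- **(Cap)(a) in every rank**: a rank-`3` set with three points pays at most `3` (simple matroids). -/
theorem cap_wgn_of_card_three (hsimple : ∀ T ⊆ M.E, T.encard ≤ 2 → M.Indep T)
    {S : Finset α} (hS : S ∈ Shadow.levelSet M 3) (hSc : S.card = 3) :
    ∑ B ∈ (Profile.Rq M 2).filter (fun B => B ⊆ S), wgn M B S ≤ 3 := by
  classical
  set Φ := (Profile.Rq M 2).filter (fun B => B ⊆ S) with hΦ
  have hSg : S ⊆ gr M := (Profile.mem_levelSet.1 hS).1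
  have hpair : ∀ B ∈ Φ, B.card = 2 ∧ (S \ B).card = 1 := by
    intro B hB
    have hBS : B ⊆ S := (Finset.mem_filter.1 hB).2
    have h2 := two_le_card_of_mem_Rq_two (Finset.mem_filter.1 hB).1
    have hne := ne_of_mem_filter_levelSet hS hB
    have hle := Finset.card_le_card hBS
    have hc : (S \ B).card = S.card - B.card := Finset.card_sdiff_of_subset hBS
    have hB3 : B.card ≠ 3 := by
      intro h3
      exact hne (Finset.eq_of_subset_of_card_le hBS (by omega))
    omega
  have hΦsub : Φ ⊆ S.powersetCard 2 := by
    intro B hB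
    rw [Finset.mem_powersetCard]
    exact ⟨(Finset.mem_filter.1 hB).2, (hpair B hB).1⟩
  have hΦcard : Φ.card ≤ 3 := by
    calc Φ.card ≤ (S.powersetCard 2).card := Finset.card_le_card hΦsub
      _ = Nat.choose 3 2 := by rw [Finset.card_powersetCard, hSc]
      _ = 3 := by decide
  by_cases hbad : ∃ B ∈ Φ, jB M B = 2 ∧ crk M S + 1 = crk M B
  · obtain ⟨B, hBΦ, hjB, hcB⟩ := hbad
    have hB2 := (hpair B hBΦ).1
    obtain ⟨z, hz⟩ := Finset.card_eq_one.1 (hpair B hBΦ).2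
    have hBS : B ⊆ S := (Finset.mem_filter.1 hBΦ).2
    have hzS : z ∈ S := by
      have : z ∈ S \ B := by rw [hz]; exact Finset.mem_singleton_self z
      exact (Finset.mem_sdiff.1 this).1
    have hzB : z ∉ B := by
      have : z ∈ S \ B := by rw [hz]; exact Finset.mem_singleton_self z
      exact (Finset.mem_sdiff.1 this).2
    have hSeq : S = insert z B := by
      ext w
      rw [Finset.mem_insert]
      constructor
      · intro hw
        by_cases hwB : w ∈ B
        · exact Or.inr hwB
        · left
          have : w ∈ S \ B := Finset.mem_sdiff.2 ⟨hw, hwB⟩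
          rw [hz] at this
          exact Finset.mem_singleton.1 this
      · rintro (rfl | hw)
        · exact hzS
        · exact hBS hw
    obtain ⟨x, y, hxy, hBxy⟩ := Finset.card_eq_two.1 hB2
    have hxg : x ∈ gr M := hSg (hBS (by rw [hBxy]; exact Finset.mem_insert_self _ _))
    have hyg : y ∈ gr M := hSg (hBS (by rw [hBxy]; exact Finset.mem_insert_of_mem (Finset.mem_singleton_self _)))
    have hzg : z ∈ gr M := hSg hzS
    have hxz : x ≠ z := by rintro rfl; exact hzB (by rw [hBxy]; exact Finset.mem_insert_self _ _)
    have hyz : y ≠ z := by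
      rintro rfl; exact hzB (by rw [hBxy]; exact Finset.mem_insert_of_mem (Finset.mem_singleton_self _))
    set r : ℚ := (crk M S : ℚ) with hr
    have hrnn : 0 ≤ r := Nat.cast_nonneg _
    -- the other pairs pay at most r/(r+1)
    have hother : ∀ B' ∈ Φ.erase B, wgn M B' S ≤ r / (r + 1) := by
      intro B' hB'
      rw [Finset.mem_erase] at hB'
      obtain ⟨x', hx'B, hB'eq⟩ := exists_eq_pair_of_subset_insert hzB hB2 (hpair B' hB'.2).1
        (by rw [← hSeq]; exact (Finset.mem_filter.1 hB'.2).2) hB'.1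
      rw [hBxy, Finset.mem_insert, Finset.mem_singleton] at hx'B
      rcases hx'B with rfl | rfl
      · rw [hB'eq, hSeq, hBxy]
        rw [hSeq, hBxy] at hS hcB
        rw [hBxy] at hjB
        have := wgn_le_of_bad_pair hsimple hxy hxz hyz hxg hyg hzg hS hjB hcB
        rw [hr, hSeq, hBxy]
        exact this
      · rw [hB'eq, hSeq, hBxy, Finset.pair_comm x x']
        rw [hSeq, hBxy, Finset.pair_comm x x'] at hS hcB
        rw [hBxy, Finset.pair_comm x x'] at hjB
        have := wgn_le_of_bad_pair hsimple hxy.symm hyz hxz hyg hxg hzg hS hjB hcB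
        rw [hr, hSeq, hBxy, Finset.pair_comm x x']
        exact this
    have hBw : wgn M B S ≤ ((crk M B : ℚ) + 2) / (crk M B : ℚ) :=
      (wgn_le_of_pair_sdiff_one (hpair B hBΦ).2 hB2).2 hjB hcB
    have hpB : (crk M B : ℚ) = r + 1 := by rw [hr, ← hcB]; push_cast; ring
    rw [hpB] at hBw
    have hcard' : (Φ.erase B).card ≤ 2 := by
      rw [Finset.card_erase_of_mem hBΦ]; omega
    have hsum : ∑ B' ∈ Φ, wgn M B' S ≤ (r + 1 + 2) / (r + 1) + 2 * (r / (r + 1)) := by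
      calc ∑ B' ∈ Φ, wgn M B' S = wgn M B S + ∑ B' ∈ Φ.erase B, wgn M B' S := (Finset.add_sum_erase Φ _ hBΦ).symm
        _ ≤ (r + 1 + 2) / (r + 1) + ∑ _B' ∈ Φ.erase B, r / (r + 1) := add_le_add hBw (Finset.sum_le_sum hother)
        _ = (r + 1 + 2) / (r + 1) + ((Φ.erase B).card : ℚ) * (r / (r + 1)) := by rw [Finset.sum_const, nsmul_eq_mul]
        _ ≤ (r + 1 + 2) / (r + 1) + 2 * (r / (r + 1)) := by
            have : ((Φ.erase B).card : ℚ) ≤ 2 := by exact_mod_cast hcard'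
            have : 0 ≤ r / (r + 1) := by positivity
            nlinarith
    have : (r + 1 + 2) / (r + 1) + 2 * (r / (r + 1)) = 3 := by
      field_simp
      ring
    linarith
  · push Not at hbad
    have hle : ∀ B ∈ Φ, wgn M B S ≤ 1 := by
      intro B hB
      exact (wgn_le_of_pair_sdiff_one (hpair B hB).2 (hpair B hB).1).1 (fun h => hbad B hB h.1 h.2)
    calc ∑ B ∈ Φ, wgn M B S ≤ ∑ _B ∈ Φ, (1 : ℚ) := Finset.sum_le_sum hle
      _ = (Φ.card : ℚ) := by rw [Finset.sum_const, nsmul_eq_mul, mul_one]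
      _ ≤ 3 := by exact_mod_cast hΦcard

end GenCapAB

end PercRepro
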